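import Literature.AnabelianGeometry.EtaleTheta.Discharge.Sec2HuuEigenSplittingOfSection
import Literature.AnabelianGeometry.EtaleTheta.Discharge.Sec2ThetaSubquotientNormal
import HarnessLib

/-!
# [EtTh] §2 AT THE §1 MODEL, FROM A CHOSEN `X̲̲` AND A SECTION: `TemperedCoverData` with `X̲̲`-member `C.Huu` over
# abc-iut-L2-t10's section cusp datum, and abc-iut-L2-t2's `OrbitEmbedding` INHABITED there (R312, hIx-free route)

Mochizuki, *The étale theta function and its Frobenioid-theoretic manifestations*, Publ. RIMS **45**
(2009) [EtTh], §2: Def. 2.1 p. 36 (p. 35 «`1 → Δ̄_Θ → D̄_x → G_K → 1`»), Prop. 2.2 pp. 36–38, Def. 2.3 p. 38,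
Prop. 2.4 p. 38, Def. 2.5 (i) p. 39 («determined, in effect, by the choice of a splitting of `D_x → G_K`»), Def. 2.7 p. 41
(PRIMS PDF pages, printed `+226`) [cite: MochizukiEtTh2009, Def 2.5 (i) p.39].

Cell abc-iut, layer L2, seat abc-iut-L2-d3 (gen 6), row R312 «ORBIT-EMBEDDING (map_Huu) @ the model». Class (b) MODEL /
CONSTRUCTION file over FROZEN interfaces (abc-iut-L2-t2's `ThetaCovers.TemperedCoverData`, `DoubleUnderline.OrbitEmbedding`);
no interface clause touched; two `def`s. TWIN of `ThetaCoversTemperedOfHuu.lean` (p449577; base = gen 4's GEOMETRIC cusp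
datum `PiCData.coverDataAx`, binder hIx — false at the Kummer-carrying χ-models) over abc-iut-L2-t10's SECTION cusp datum
`PiCData.coverDataAxOfSection` (p449075, `D_x := Δ̄_Θ-preimage · incl(toHat(s(G_K)))`, no hIx, no cusp) and their
`Sec2Def21OfSection` (p450022) / `ThetaCoversTemperedOfSection` (the un-pinned assembly); proof-only inputs =
`Sec2HuuClosureModel` (p447270), `Sec2HuuEigenSplittingOfSection` (abc-iut-L2-t10 p451053 / this seat p450817):

* **`CLevelData.temperedCoverDataOfHuuOfSection … : TemperedCoverData l`** — `Π_{C̲̲} := cl(ιC(inclX(C.Huu)))·⟨ι₀⟩` for the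
  inversion `ι₀` of `exists_inversion_ofHuuOfSection`; tempered part as in gen 5; with `…_PiXuu` (`T.PiXuu = H`),
  **`…_tp_PiXuu : T.tp T.PiXuu = C.Huu.map M.inclX`** (abc-iut-L2-t2's `OrbitEmbedding.map_Huu` AS A THEOREM), `…_PiXu`
  (`= Π_X̲`), `…_tp_PiXu`, `…_PiYtp_le_tp_PiXu` (Def. 2.5 (i)(a)), `…_aug_toHat_inclX`;
* **`CLevelData.orbitEmbeddingOfHuuOfSection … (τ τ') : C.OrbitEmbedding T`** + `nonempty_…`.

HONEST RESIDUE (named binders; no new `Prop` fact): `op : OncePuncturedData`; a homomorphic section `s` of `aug` valued in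
`Π^tp_Y` (`hsa`, `hsZ`) LANDING IN `Π^tp_{X̲̲}` (`hsH` — the group-theoretic content of «`X̲̲` determined by a splitting of
`D_x → G_K`»; it replaces abc-iut-L2-t8's `CuspAdapted`); P-C4 `hιell`; P-C7 `hN`, `hY` (L02); `hK : barKerTp l ≤ C.Huu`
(G-L2d3-7); `C.IotaStable (e.conjX g)` (census C10); `τ, τ'` data. The cusp datum is the SYNTHETIC `D̄_x`-preimage of the
section (abc-iut-L2-t10's honest label). Nothing asserts that a `MuTwoSetting` exists; [EtTh] is refereed; no side is taken
on [IUTchIII] Cor. 3.12; typed ≠ proved.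
-/

noncomputable section

namespace Literature.AnabelianGeometry.EtaleTheta

open Literature.AnabelianGeometry.SemiGraphs ThetaCovers
open _root_.Topology

namespace MuTwoSetting.CLevelData

variable {p : ℕ} [Fact p.Prime] {M : MuTwoSetting p}
variable {PC : Type} [Group PC] [TopologicalSpace PC] [IsTopologicalGroup PC] [T2Space PC]

/-! ### The assembly -/

/-- **An inhabitant of `TemperedCoverData l` at the [EtTh] §1 model whose `X̲̲`-member IS the chosen
`X̲̲ = C.Huu`** (Def. 2.3 / 2.5 (i)): profinite part = abc-iut-L2-t10's `PiCData.coverDataAxOfSection` (section cusp datum) over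
`I := e.piCDataOf ιC hιC`; `Π_{C̲̲} := cl(ιC(inclX(C.Huu)))·⟨ι₀⟩` for the inversion `ι₀` of
`exists_inversion_ofHuu`; tempered part as in gen 5's `temperedCoverData` (`Π^tp_C := M.GtpC`,
`toHat := ιC`, `Π^tp_Y := inclX(Ker toZ)`, `Π^tp_Ÿ := inclX(Π^tp_Ÿ)`, `Π^tp_Ċ := dotC ε_Z`). Binders: see the
module docstring. [cite: MochizukiEtTh2009, Def 2.5 (i) p.39] -/
def temperedCoverDataOfHuuOfSection (e : M.CLevelData) (ιC : M.GtpC →ₜ* PC) (hιC : IsProfiniteCompletion ιC)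
    (hinj : Function.Injective ιC) (op : M.toThetaSetting.OncePuncturedData) {l : ℕ} (hodd : Odd l)
    (s : ↥M.GK →* M.PiTemp) (hsa : ∀ σ, M.aug (s σ) = (σ : GQp p)) (hsZ : ∀ σ, M.toZ (s σ) = 1)
    (hιell : ∀ c ∈ (e.piCDataOf ιC hιC).augGK.ker, c ∉ (e.piCDataOf ιC hιC).PiX →
      ∀ d ∈ (e.piCDataOf ιC hιC).PiX ⊓ (e.piCDataOf ιC hιC).augGK.ker,
        c * d * c⁻¹ * d ∈ (e.piCDataOf ιC hιC).barTheta l)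
    (hN : ((M.GtpXu l).map M.inclX).Normal) (hY : (M.GtpY.map M.inclX).Normal)
    {E : M.toThetaSetting.EtaleThetaData} (C : E.DoubleUnderline l) (hK : M.barKerTp l ≤ C.Huu)
    (hsH : ∀ σ, s σ ∈ C.Huu) {g : M.GtpC} (hgX : g ∉ M.inclX.range) (hι : C.IotaStable (e.conjX g)) :
    TemperedCoverData.{0} l :=
  { (e.piCDataOf ιC hιC).coverDataAxOfSection l op hodd s hsa hιell
      ((e.piCDataOf ιC hιC).inv_theta_of_inv_ell l op hιell) with
    PiCuu := ((C.Huu.map M.inclX).map ιC.toMonoidHom).topologicalClosure ⊔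
      Subgroup.zpowers (Classical.choose (e.exists_inversion_ofHuuOfSection ιC hιC op hodd s hsa hsZ hιell hN C hK hgX hι hsH))
    isTypeLTorsThetaPm :=
      (Classical.choose_spec (e.exists_inversion_ofHuuOfSection ιC hιC op hodd s hsa hsZ hιell hN C hK hgX hι hsH)).1
    isOpen_PiCuu' := Subgroup.isOpen_mono le_sup_left (e.isOpen_closureHuu ιC hιC C)
    Gtp := M.GtpC
    toHat := ιC.toMonoidHom
    continuous_toHat := ιC.continuous
    injective_toHat := hinj
    isProfiniteCompletion_toHat := hιC
    PiYtp := M.GtpY.map M.inclX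
    PiYtp_le := map_inclX_GtpY_le ιC hιC _ (e.piCDataOf_incl_toHat ιC hιC)
    PiYtp_normal := hY
    isOpen_PiYtp := e.isOpen_map_inclX_GtpY
    quotZ := by
      haveI := hY
      exact nonempty_quot_map_inclX_GtpY_mulEquiv ιC hιC _ (e.piCDataOf_incl_toHat ιC hιC)
    PiYddtp := M.GtpYdd.map M.inclX
    PiYddtp_le := map_inclX_GtpYdd_le M
    isOpen_PiYddtp := e.isOpen_map_inclX_GtpYdd
    relIndex_PiYddtp := relIndex_map_inclX_GtpYdd M
    PiCdot := M.dotC (Classical.choose M.exists_isAdmissibleEpsZ)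
    index_PiCdot := M.index_dotC (Classical.choose_spec M.exists_isAdmissibleEpsZ)
    isOpen_PiCdot := e.isOpen_dotC _
    PiCdot_ne := dotC_ne_comap_range ιC hιC _ (e.piCDataOf_incl_toHat ιC hιC)
      (Classical.choose_spec M.exists_isAdmissibleEpsZ) }

section Identities

variable (e : M.CLevelData) (ιC : M.GtpC →ₜ* PC) (hιC : IsProfiniteCompletion ιC)
  (hinj : Function.Injective ιC) (op : M.toThetaSetting.OncePuncturedData) {l : ℕ} (hodd : Odd l)
  (s : ↥M.GK →* M.PiTemp) (hsa : ∀ σ, M.aug (s σ) = (σ : GQp p)) (hsZ : ∀ σ, M.toZ (s σ) = 1)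
  (hιell : ∀ c ∈ (e.piCDataOf ιC hιC).augGK.ker, c ∉ (e.piCDataOf ιC hιC).PiX →
    ∀ d ∈ (e.piCDataOf ιC hιC).PiX ⊓ (e.piCDataOf ιC hιC).augGK.ker,
      c * d * c⁻¹ * d ∈ (e.piCDataOf ιC hιC).barTheta l)
  (hN : ((M.GtpXu l).map M.inclX).Normal) (hY : (M.GtpY.map M.inclX).Normal)
  {E : M.toThetaSetting.EtaleThetaData} (C : E.DoubleUnderline l) (hK : M.barKerTp l ≤ C.Huu)
  (hsH : ∀ σ, s σ ∈ C.Huu) {g : M.GtpC} (hgX : g ∉ M.inclX.range) (hι : C.IotaStable (e.conjX g))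

/-- The underlying `CoverDataAx` of `temperedCoverDataOfHuuOfSection` IS abc-iut-L2-t10's `PiCData.coverDataAx`; its
`Π^tp_C`, `toHat`, `Π^tp_Y`, `Π^tp_Ÿ` are `M.GtpC`, `ιC`, `inclX(Π^tp_Y)`, `inclX(Π^tp_Ÿ)` (rfl bookkeeping).
[cite: MochizukiEtTh2009, Def 2.1 p.36] -/
theorem temperedCoverDataOfHuuOfSection_toCoverDataAx :
    (e.temperedCoverDataOfHuuOfSection ιC hιC hinj op hodd s hsa hsZ hιell hN hY C hK hsH hgX hι).toCoverDataAx =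
      (e.piCDataOf ιC hιC).coverDataAxOfSection l op hodd s hsa hιell
        ((e.piCDataOf ιC hιC).inv_theta_of_inv_ell l op hιell) ∧
    (e.temperedCoverDataOfHuuOfSection ιC hιC hinj op hodd s hsa hsZ hιell hN hY C hK hsH hgX hι).Gtp = M.GtpC ∧
    (e.temperedCoverDataOfHuuOfSection ιC hιC hinj op hodd s hsa hsZ hιell hN hY C hK hsH hgX hι).toHat = ιC.toMonoidHom ∧
    (e.temperedCoverDataOfHuuOfSection ιC hιC hinj op hodd s hsa hsZ hιell hN hY C hK hsH hgX hι).PiYtp = M.GtpY.map M.inclX ∧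
    (e.temperedCoverDataOfHuuOfSection ιC hιC hinj op hodd s hsa hsZ hιell hN hY C hK hsH hgX hι).PiYddtp =
      M.GtpYdd.map M.inclX :=
  ⟨rfl, rfl, rfl, rfl, rfl⟩

/-- **`Π_{C̲̲}` of the assembled cover is `H·⟨ι₀⟩`** for an inversion `ι₀ ∈ Δ_C ∖ Π_X` with `ι₀² ∈ Ker`
normalising `H := cl(ιC(inclX(C.Huu)))`. [cite: MochizukiEtTh2009, Def 2.3 p.38] -/
theorem temperedCoverDataOfHuuOfSection_PiCuu :
    ∃ ι₀ : PC, ι₀ ∈ (e.piCDataOf ιC hιC).augGK.ker ∧ ι₀ ∉ (e.piCDataOf ιC hιC).PiX ∧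
      ι₀ * ι₀ ∈ (e.piCDataOf ιC hιC).barKer l ∧
      (∀ h ∈ ((C.Huu.map M.inclX).map ιC.toMonoidHom).topologicalClosure,
        ι₀ * h * ι₀⁻¹ ∈ ((C.Huu.map M.inclX).map ιC.toMonoidHom).topologicalClosure) ∧
      (e.temperedCoverDataOfHuuOfSection ιC hιC hinj op hodd s hsa hsZ hιell hN hY C hK hsH hgX hι).PiCuu =
        ((C.Huu.map M.inclX).map ιC.toMonoidHom).topologicalClosure ⊔ Subgroup.zpowers ι₀ := by
  have h := Classical.choose_spec (e.exists_inversion_ofHuuOfSection ιC hιC op hodd s hsa hsZ hιell hN C hK hgX hι hsH)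
  exact ⟨_, h.2.2.1, h.2.2.2.1, h.2.2.2.2.1, h.2.2.2.2.2, rfl⟩

/-- **`Π_{X̲̲}` of the assembled cover IS `H = cl(ιC(inclX(C.Huu)))`** (`T.PiXuu = Π_{C̲̲} ∩ Π_X = H`).
[cite: MochizukiEtTh2009, Def 2.3 p.38] -/
theorem temperedCoverDataOfHuuOfSection_PiXuu :
    (e.temperedCoverDataOfHuuOfSection ιC hιC hinj op hodd s hsa hsZ hιell hN hY C hK hsH hgX hι).PiXuu =
      ((C.Huu.map M.inclX).map ιC.toMonoidHom).topologicalClosure :=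
  (Classical.choose_spec (e.exists_inversion_ofHuuOfSection ιC hιC op hodd s hsa hsZ hιell hN C hK hgX hι hsH)).2.1

/-- **`OrbitEmbedding.map_Huu` AS A THEOREM at the model: `Π^tp_{X̲̲}` of the assembled cover IS
`inclX(C.Huu)`** — "`Π^tp_{X̲̲}` of `T` (pulled back to `Π^tp_C`) is the image of the chosen `Π^tp_{X̲̲} = C.Huu`"
(census C10; `ιC⁻¹(cl(ιC(inclX(Huu)))) = inclX(Huu)` for the open finite-index `Huu`).
[cite: MochizukiEtTh2009, Def 2.5 (i) p.39] -/
theorem temperedCoverDataOfHuuOfSection_tp_PiXuu :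
    (e.temperedCoverDataOfHuuOfSection ιC hιC hinj op hodd s hsa hsZ hιell hN hY C hK hsH hgX hι).tp
        (e.temperedCoverDataOfHuuOfSection ιC hιC hinj op hodd s hsa hsZ hιell hN hY C hK hsH hgX hι).PiXuu =
      C.Huu.map M.inclX := by
  rw [TemperedCoverData.tp, temperedCoverDataOfHuuOfSection_PiXuu]
  exact e.comap_closureHuu ιC hιC C

/-- **`Π_X̲` of the assembled cover IS `cl(ιC(inclX(Π^tp_X̲)))`** (`T.PiXu = Π_{X̲̲}·Δ̄_Θ-preimage = H·Δ_X̲ = Π_X̲`).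
[cite: MochizukiEtTh2009, Def 2.1 p.36] -/
theorem temperedCoverDataOfHuuOfSection_PiXu :
    (e.temperedCoverDataOfHuuOfSection ιC hιC hinj op hodd s hsa hsZ hιell hN hY C hK hsH hgX hι).PiXu =
      (((M.GtpXu l).map M.inclX).map ιC.toMonoidHom).topologicalClosure := by
  set I := e.piCDataOf ιC hιC with hI
  set H := ((C.Huu.map M.inclX).map ιC.toMonoidHom).topologicalClosure with hH
  set Xu := (((M.GtpXu l).map M.inclX).map ιC.toMonoidHom).topologicalClosure with hXu
  haveI : NeZero l := ⟨by obtain ⟨k, hk⟩ := hodd; omega⟩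
  rw [TemperedCoverData.PiXu, temperedCoverDataOfHuuOfSection_PiXuu]
  change H ⊔ I.barTheta l = Xu
  have hHXu : H ≤ Xu := closureHuu_le_closureXu ιC C
  refine le_antisymm (sup_le hHXu (e.barTheta_le_closureXu ιC hιC op l)) fun z hz => ?_
  obtain ⟨h, hh, d, hd, rfl⟩ := e.exists_closureHuu_mul_delta_eq ιC hιC C hz
  have hEc := e.isMinusEigen_ofHuuOfSection ιC hιC op hodd s hsa hsZ hιell hN C hK ⊤
    (Classical.choose_spec (e.exists_inversion_ofHuuOfSection ιC hιC op hodd s hsa hsZ hιell hN C hK hgX hι hsH)).2.2.1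
    (Classical.choose_spec (e.exists_inversion_ofHuuOfSection ιC hιC op hodd s hsa hsZ hιell hN C hK hgX hι hsH)).2.2.2.1
    (fun e' he' => ⟨(Classical.choose_spec
        (e.exists_inversion_ofHuuOfSection ιC hιC op hodd s hsa hsZ hιell hN C hK hgX hι hsH)).2.2.2.2.2 e' he'.1,
      (MonoidHom.normal_ker _).conj_mem _ he'.2 _⟩)
  have hd' : d ∈ (H ⊓ I.augGK.ker) ⊔ I.barTheta l := hEc.sup_eq.ge hd
  exact Subgroup.mul_mem _ (Subgroup.mem_sup_left hh)
    ((sup_le_sup_right (inf_le_left : H ⊓ I.augGK.ker ≤ H) _) hd')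

/-- **`Π^tp_X̲` of the assembled cover IS `inclX(Π^tp_X̲)`**. [cite: MochizukiEtTh2009, Prop 2.4 p.38] -/
theorem temperedCoverDataOfHuuOfSection_tp_PiXu :
    (e.temperedCoverDataOfHuuOfSection ιC hιC hinj op hodd s hsa hsZ hιell hN hY C hK hsH hgX hι).tp
        (e.temperedCoverDataOfHuuOfSection ιC hιC hinj op hodd s hsa hsZ hιell hN hY C hK hsH hgX hι).PiXu =
      (M.GtpXu l).map M.inclX := by
  haveI : NeZero l := ⟨by obtain ⟨k, hk⟩ := hodd; omega⟩
  haveI : (M.GtpXu l).FiniteIndex := ⟨by rw [M.index_GtpXu l]; exact NeZero.ne l⟩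
  rw [TemperedCoverData.tp, temperedCoverDataOfHuuOfSection_PiXu]
  exact e.comap_closure_map_inclX ιC hιC _ (M.isOpen_GtpXu l)

/-- **Def. 2.5 (i)(a) HOLDS for the assembled cover**: `Π^tp_Y ≤ Π^tp_X̲`. [cite: MochizukiEtTh2009, Def 2.5(i) p.39] -/
theorem temperedCoverDataOfHuuOfSection_PiYtp_le_tp_PiXu :
    (e.temperedCoverDataOfHuuOfSection ιC hιC hinj op hodd s hsa hsZ hιell hN hY C hK hsH hgX hι).PiYtp ≤
      (e.temperedCoverDataOfHuuOfSection ιC hιC hinj op hodd s hsa hsZ hιell hN hY C hK hsH hgX hι).tp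
        (e.temperedCoverDataOfHuuOfSection ιC hιC hinj op hodd s hsa hsZ hιell hN hY C hK hsH hgX hι).PiXu := by
  rw [temperedCoverDataOfHuuOfSection_tp_PiXu]
  exact Subgroup.map_mono (M.GtpY_le_GtpXu l)

/-- The composite augmentation `Π^tp_X → Π^tp_C → Π_C → G_K` of the assembled cover is the §1 augmentation
(abc-iut-L2-t2's `OrbitEmbedding.aug_ι` with `gk := MulEquiv.refl`). [cite: MochizukiEtTh2009, Def 2.1 p.36] -/
theorem temperedCoverDataOfHuuOfSection_aug_toHat_inclX (z : M.PiTemp) :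
    (e.temperedCoverDataOfHuuOfSection ιC hιC hinj op hodd s hsa hsZ hιell hN hY C hK hsH hgX hι).aug
        ((e.temperedCoverDataOfHuuOfSection ιC hιC hinj op hodd s hsa hsZ hιell hN hY C hK hsH hgX hι).toHat (M.inclX z)) =
      (MulEquiv.refl ↥M.GK) ⟨M.aug z, M.aug_mem_GK z⟩ := by
  apply Subtype.ext
  show (((e.piCDataOf ιC hιC).augGK (ιC (M.inclX z)) : M.GK) : GQp p) = M.aug z
  rw [ThetaSetting.PiCData.coe_augGK_apply, e.piCDataOf_aug_inclX]

/-! ### abc-iut-L2-t2's `OrbitEmbedding` INHABITED at the model -/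

/-- **An `OrbitEmbedding` of the chosen `X̲̲` into the assembled cover** (Def. 2.7 at the §1 model):
`ι := inclX` (injective), `ι(Π^tp_Ÿ) = T.PiYddtp` (rfl), **`ι(Π^tp_{X̲̲}) = Π^tp_{X̲̲}` of `T`**
(`temperedCoverDataOfHuuOfSection_tp_PiXuu`), normality in `Π^tp_C` of `ι(toTheta⁻¹ Δ_Θ)` and `ι(Ker toTheta)`
(gen 4, `Sec2ThetaSubquotientNormal`), `G_K = T.GK` (`MulEquiv.refl`) compatibly with the augmentations,
and the two points `τ^{±1}` of Def. 1.9 as DATA. [cite: MochizukiEtTh2009, Def 2.7 p.41] -/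
def orbitEmbeddingOfHuuOfSection (τ τ' : ThetaSetting.NonCuspidalPoint E.toKummerData) :
    C.OrbitEmbedding (e.temperedCoverDataOfHuuOfSection ιC hιC hinj op hodd s hsa hsZ hιell hN hY C hK hsH hgX hι) where
  ι := M.inclX
  injective_ι := M.injective_inclX
  map_GtpYdd := rfl
  map_Huu := (e.temperedCoverDataOfHuuOfSection_tp_PiXuu ιC hιC hinj op hodd s hsa hsZ hιell hN hY C hK hsH hgX hι).symm
  normal_top := e.map_inclX_comap_deltaTheta_normal
  normal_bot := e.map_inclX_ker_toTheta_normal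
  gk := MulEquiv.refl _
  aug_ι := e.temperedCoverDataOfHuuOfSection_aug_toHat_inclX ιC hιC hinj op hodd s hsa hsZ hιell hN hY C hK hsH hgX hι
  tau := τ
  tauInv := τ'

/-- **abc-iut-L2-t2's `OrbitEmbedding C T` is INHABITED at the [EtTh] §1 model** for the cover assembled from
the chosen `X̲̲ = C.Huu`, modulo the named binders of `temperedCoverDataOfHuuOfSection` and two non-cuspidal points
`τ^{±1}` (Def. 1.9). [cite: MochizukiEtTh2009, Def 2.7 p.41] -/
theorem nonempty_orbitEmbeddingOfHuuOfSection (τ τ' : ThetaSetting.NonCuspidalPoint E.toKummerData) :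
    Nonempty (C.OrbitEmbedding (e.temperedCoverDataOfHuuOfSection ιC hιC hinj op hodd s hsa hsZ hιell hN hY C hK hsH hgX hι)) :=
  ⟨e.orbitEmbeddingOfHuuOfSection ιC hιC hinj op hodd s hsa hsZ hιell hN hY C hK hsH hgX hι τ τ'⟩

end Identities

end MuTwoSetting.CLevelData

end Literature.AnabelianGeometry.EtaleTheta

end
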